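import Summits.KontsevichZagierPeriods.KontsevichZagierPeriods.Theorems.SymplecticScissorsRealOnePeriodRelationsStubRealises
import Literature.NumberTheory.Transcendental.CurvePeriodsPuncturedLineProofs
import Literature.NumberTheory.Transcendental.CurvePeriodsEllipticFormsProofs
import Literature.NumberTheory.DiophantineGeometry.BelyiPolynomialHeightProofs
import Mathlib.FieldTheory.AlgebraicClosure
import Mathlib.FieldTheory.IsAlgClosed.Basic

/-!
# `RealOnePeriodRelations` (stmt-KontsevichZagierPeriods-10042), line `nash-retraction-thin-strip`,
# reshape 3 (the unconditional rational layer): stub `stub_ratSymbol`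

A UNIT RATIONAL CELL IS THE REAL REALISATION OF A PERIOD SYMBOL ON A PUNCTURED LINE.  For polynomials
`P₀, Q₀` with real algebraic coefficients such that `Q₀` has no zero on `[0,1]` we build the period symbol
`s = (Z_a, G dx, γ)` of curve type (Huber–Wüstholz 2022, §3.3.1) with

* `Z_a = {(x, y) ∈ 𝔸² | y · ∏ᵢ (x − aᵢ) = 1}`, the punctured line at the DISTINCT complex roots
  `a₁, …, a_r` of `Q₀` (pairwise distinct and algebraic);
* `G = lc(Q₀)⁻¹ · (P₀ U)(x) · yᴺ`, where `N = deg Q₀` and `U = ∏_b (x − b)^{N − mult_b(Q₀)}` is the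
  cofactor with `Q₀ · U = lc(Q₀) · (∏ᵢ (x − aᵢ))ᴺ`;
* `γ(t) = (t, 1/∏ᵢ (t − aᵢ))`, the section of `Z_a` over the parameter line,

and check: the realified path is `ℚ`-semialgebraic on `[0,1]` and the integrand of the period,
`Σᵢ ωᵢ(γ(t)) γᵢ′(t) = G(γ(t))`, equals `P₀(t)/Q₀(t)` on `[0,1]`.  With the landed `stub_realises` this makes the
unit cell `[∫_{(0,1)} P₀/Q₀]` the real realisation of `s`, a symbol on which the tree's genus-0 case of
Huber–Wüstholz's theorem (`CurvePeriods.huberWustholzCurvePeriods_of_puncturedLine`) operates.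
[cite: HuberWustholz2022, §3.3.1 and Cor. 12.7]
-/

noncomputable section

open scoped BigOperators Polynomial
open Set MeasureTheory MvPolynomial
open Literature.NumberTheory.Transcendental Literature.NumberTheory.Transcendental.CurvePeriods
open Literature.ModelTheory.ExponentialFields (IsSemialgebraic)

namespace Summit.KontsevichZagierPeriods.SymplecticScissors.RealOnePeriodRelations.RationalLayer

/-! ## Algebraic bookkeeping -/

/-- The complexification `Q_ℂ` of a polynomial `Q` with real algebraic coefficients has algebraic
coefficients. [folklore] -/
theorem isAlgebraic_coeff_mapC (Q : Polynomial (algebraicClosure ℚ ℝ)) (n : ℕ) :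
    IsAlgebraic ℚ (((Q.map (algebraMap (algebraicClosure ℚ ℝ) ℝ)).map (algebraMap ℝ ℂ)).coeff n) := by
  rw [Polynomial.coeff_map, Polynomial.coeff_map]
  exact (mem_algebraicClosure_iff.mp (Q.coeff n).2).algebraMap.algebraMap

/-- Evaluation of the complexification at a real point: `Q_ℂ(t) = Q(t)`. [folklore] -/
theorem eval_mapC (Q : Polynomial (algebraicClosure ℚ ℝ)) (t : ℝ) :
    ((Q.map (algebraMap (algebraicClosure ℚ ℝ) ℝ)).map (algebraMap ℝ ℂ)).eval (t : ℂ) =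
      ((Polynomial.aeval t Q : ℝ) : ℂ) := by
  rw [Polynomial.eval_map, show (t : ℂ) = algebraMap ℝ ℂ t from rfl, Polynomial.eval₂_at_apply,
    Polynomial.eval_map, ← Polynomial.aeval_def]
  rfl

/-- Differences `X − b` with `b` algebraic have algebraic coefficients. [folklore] -/
theorem algPoly_X_sub_C {b : ℂ} (hb : IsAlgebraic ℚ b) :
    ∀ n, IsAlgebraic ℚ ((Polynomial.X - Polynomial.C b : ℂ[X]).coeff n) := by
  rw [sub_eq_add_neg, ← Polynomial.C_neg]
  exact Weier.algPoly_add Weier.algPoly_X (Weier.algPoly_C hb.neg)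

/-- Finite products of polynomials with algebraic coefficients have algebraic coefficients. [folklore] -/
theorem algPoly_finsetProd {ι : Type*} (s : Finset ι) (f : ι → ℂ[X])
    (hf : ∀ i ∈ s, ∀ n, IsAlgebraic ℚ ((f i).coeff n)) : ∀ n, IsAlgebraic ℚ ((∏ i ∈ s, f i).coeff n) := by
  classical
  induction s using Finset.induction_on with
  | empty =>
    intro n
    rw [Finset.prod_empty, ← Polynomial.C_1]
    exact Weier.algPoly_C isAlgebraic_one n
  | insert i s hi ih =>
    rw [Finset.prod_insert hi]
    exact Weier.algPoly_mul (hf i (Finset.mem_insert_self i s))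
      (ih fun j hj => hf j (Finset.mem_insert_of_mem hj))

/-! ## The symbol -/

/-- **Stub `stub_ratSymbol`** — a unit rational cell is the real realisation of a period symbol on a
punctured line.  For `P₀, Q₀` with real algebraic coefficients and `Q₀ ≠ 0` on `[0,1]`, the symbol
`s = (Z_a, G dx, γ)` described in the module docstring has `ℚ`-semialgebraic path coordinates and integrand
`Σᵢ ωᵢ(γ(t)) γᵢ′(t) = P₀(t)/Q₀(t)` on `[0,1]`. [cite: HuberWustholz2022, §3.3.1] -/
theorem stub_ratSymbol : ∀ (P₀ Q₀ : Polynomial (algebraicClosure ℚ ℝ)),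
    (∀ t ∈ Set.Icc (0 : ℝ) 1, Polynomial.aeval t Q₀ ≠ 0) →
    ∃ s : PeriodSymbol,
      (∃ (r : ℕ) (a : Fin r → ℂ), Function.Injective a ∧ (∀ i, IsAlgebraic ℚ (a i)) ∧
        s.Z = (⟨2, 1, ![X 1 * ∏ i, (X 0 - MvPolynomial.C (a i)) - 1]⟩ : CurveData)) ∧
      IsSemialgebraicMapOn ℚ {z : Fin 1 → ℝ | z 0 ∈ Set.Icc (0 : ℝ) 1}
        (fun z => Fin.append (fun i => (s.γ.toFun (z 0) i).re) (fun i => (s.γ.toFun (z 0) i).im)) ∧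
      ∀ t ∈ Set.Icc (0 : ℝ) 1,
        (∑ i, MvPolynomial.eval (s.γ.toFun t) (s.ω i) * deriv (fun u => s.γ.toFun u i) t) =
          ((Polynomial.aeval t P₀ / Polynomial.aeval t Q₀ : ℝ) : ℂ) := by
  classical
  intro P₀ Q₀ hQ₀
  ------------------------------------------------------------------
  -- the complexified polynomials
  ------------------------------------------------------------------
  set PC : ℂ[X] := (P₀.map (algebraMap (algebraicClosure ℚ ℝ) ℝ)).map (algebraMap ℝ ℂ) with hPCdef
  set QC : ℂ[X] := (Q₀.map (algebraMap (algebraicClosure ℚ ℝ) ℝ)).map (algebraMap ℝ ℂ) with hQCdef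
  have hPCalg : ∀ n, IsAlgebraic ℚ (PC.coeff n) := isAlgebraic_coeff_mapC P₀
  have hQCalg : ∀ n, IsAlgebraic ℚ (QC.coeff n) := isAlgebraic_coeff_mapC Q₀
  have hPCeval : ∀ t : ℝ, PC.eval (t : ℂ) = ((Polynomial.aeval t P₀ : ℝ) : ℂ) := eval_mapC P₀
  have hQCeval : ∀ t : ℝ, QC.eval (t : ℂ) = ((Polynomial.aeval t Q₀ : ℝ) : ℂ) := eval_mapC Q₀
  have hQCne : ∀ t ∈ Set.Icc (0 : ℝ) 1, QC.eval (t : ℂ) ≠ 0 := fun t ht => by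
    rw [hQCeval]
    exact_mod_cast hQ₀ t ht
  have hQC0 : QC ≠ 0 := fun h =>
    hQCne 0 ⟨le_rfl, zero_le_one⟩ (by rw [h, Polynomial.eval_zero])
  ------------------------------------------------------------------
  -- the punctures: the distinct complex roots of `Q_ℂ`
  ------------------------------------------------------------------
  set T : Finset ℂ := QC.roots.toFinset with hTdef
  set e := T.equivFin with hedef
  set a : Fin T.card → ℂ := fun i => ((e.symm i : T) : ℂ) with hadef
  have ha_inj : Function.Injective a := Subtype.val_injective.comp e.symm.injective
  have ha_mem : ∀ i, a i ∈ QC.roots := fun i => Multiset.mem_toFinset.1 (e.symm i).2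
  have ha_alg : ∀ i, IsAlgebraic ℚ (a i) := fun i =>
    Literature.NumberTheory.DiophantineGeometry.isAlgebraic_of_mem_roots_of_isAlgebraic_coeff hQCalg (ha_mem i)
  -- `∏_{b ∈ T} f b = ∏ᵢ f (a i)`
  have hreindex : ∀ f : ℂ → ℂ[X], ∏ b ∈ T, f b = ∏ i, f (a i) := by
    intro f
    rw [← Finset.prod_coe_sort T]
    exact (Fintype.prod_equiv e.symm (fun i => f (a i)) (fun x => f x) fun i => rfl).symm
  ------------------------------------------------------------------
  -- the factorisation `Q_ℂ · U = lc · (∏ᵢ (X − aᵢ))ᴺ`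
  ------------------------------------------------------------------
  set N : ℕ := QC.natDegree with hNdef
  set lc : ℂ := QC.leadingCoeff with hlcdef
  have hlc : lc ≠ 0 := Polynomial.leadingCoeff_ne_zero.2 hQC0
  have hlcalg : IsAlgebraic ℚ lc := hQCalg _
  have hcard : Multiset.card QC.roots = QC.natDegree := IsAlgClosed.card_roots_eq_natDegree
  have hmN : ∀ b, QC.roots.count b ≤ N := fun b =>
    (Multiset.count_le_card b _).trans hcard.le
  set U : ℂ[X] := ∏ b ∈ T, (Polynomial.X - Polynomial.C b) ^ (N - QC.roots.count b) with hUdef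
  have hUalg : ∀ n, IsAlgebraic ℚ (U.coeff n) :=
    algPoly_finsetProd T _ fun b hb =>
      Weier.algPoly_pow (algPoly_X_sub_C
        (Literature.NumberTheory.DiophantineGeometry.isAlgebraic_of_mem_roots_of_isAlgebraic_coeff hQCalg
          (Multiset.mem_toFinset.1 hb))) _
  have hfac : QC = Polynomial.C lc * ∏ b ∈ T, (Polynomial.X - Polynomial.C b) ^ QC.roots.count b := by
    have h := Polynomial.C_leadingCoeff_mul_prod_multiset_X_sub_C hcard
    rw [Finset.prod_multiset_map_count] at h
    exact h.symm
  have hkey : QC * U = Polynomial.C lc * (∏ i, (Polynomial.X - Polynomial.C (a i))) ^ N := by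
    rw [← hreindex fun b => Polynomial.X - Polynomial.C b, ← Finset.prod_pow]
    conv_lhs => rw [hfac]
    rw [mul_assoc, ← Finset.prod_mul_distrib]
    congr 1
    refine Finset.prod_congr rfl fun b _ => ?_
    rw [← pow_add, Nat.add_sub_cancel' (hmN b)]
  -- the radical does not vanish on `[0,1]`
  have hrad_ne : ∀ t ∈ Set.Icc (0 : ℝ) 1, ∏ i, ((t : ℂ) - a i) ≠ 0 := by
    intro t ht h
    obtain ⟨i, -, hi⟩ := Finset.prod_eq_zero_iff.1 h
    have hroot : (t : ℂ) ∈ QC.roots := by rw [sub_eq_zero.1 hi]; exact ha_mem i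
    have h0 := (Polynomial.mem_roots hQC0).1 hroot
    exact hQCne t ht h0
  -- evaluated factorisation: `U(t) · (∏ᵢ (t − aᵢ))⁻ᴺ = lc / Q_ℂ(t)` in the form used below
  have hUeval : ∀ t ∈ Set.Icc (0 : ℝ) 1,
      QC.eval (t : ℂ) * U.eval (t : ℂ) = lc * (∏ i, ((t : ℂ) - a i)) ^ N := by
    intro t _
    have h := congrArg (Polynomial.eval (t : ℂ)) hkey
    simp only [Polynomial.eval_mul, Polynomial.eval_C, Polynomial.eval_pow, Polynomial.eval_prod,
      Polynomial.eval_sub, Polynomial.eval_X] at h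
    exact h
  ------------------------------------------------------------------
  -- the path `γ(t) = (t, 1/∏ᵢ (t − aᵢ))`
  ------------------------------------------------------------------
  have hrad_cd : ContDiff ℝ 1 (fun t : ℝ => ∏ i, ((t : ℂ) - a i)) :=
    contDiff_prod fun i _ => Complex.ofRealCLM.contDiff.sub contDiff_const
  let γ : CurvePath (⟨2, 1, ![X 1 * ∏ i, (X 0 - MvPolynomial.C (a i)) - 1]⟩ : CurveData) :=
    { toFun := fun t => ![(t : ℂ), (∏ i, ((t : ℂ) - a i))⁻¹]
      contDiffOn := by
        refine contDiffOn_pi.2 fun i => ?_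
        fin_cases i
        · exact Complex.ofRealCLM.contDiff.comp_contDiffOn contDiffOn_id
        · exact hrad_cd.contDiffOn.inv hrad_ne
      mem_points := fun t ht => by
        rw [mem_points_puncturedLine_iff]
        simp only [Matrix.cons_val_one, Matrix.cons_val_fin_one, Matrix.cons_val_zero]
        exact inv_mul_cancel₀ (hrad_ne t ht)
      algebraic_zero := fun i => by
        fin_cases i
        · show IsAlgebraic ℚ (((0 : ℝ)) : ℂ)
          rw [Complex.ofReal_zero]
          exact isAlgebraic_zero
        · show IsAlgebraic ℚ (∏ i, (((0 : ℝ) : ℂ) - a i))⁻¹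
          exact (isAlgebraic_finsetProd _ _ fun i _ => (by
            rw [Complex.ofReal_zero]; exact isAlgebraic_zero.sub (ha_alg i))).inv
      algebraic_one := fun i => by
        fin_cases i
        · show IsAlgebraic ℚ (((1 : ℝ)) : ℂ)
          rw [Complex.ofReal_one]
          exact isAlgebraic_one
        · show IsAlgebraic ℚ (∏ i, (((1 : ℝ) : ℂ) - a i))⁻¹
          exact (isAlgebraic_finsetProd _ _ fun i _ => (by
            rw [Complex.ofReal_one]; exact isAlgebraic_one.sub (ha_alg i))).inv }
  have hγ : γ.toFun = fun t : ℝ => (![(t : ℂ), (∏ i, ((t : ℂ) - a i))⁻¹] : Fin 2 → ℂ) := rfl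
  ------------------------------------------------------------------
  -- the form `G dx`, `G = lc⁻¹ · (P_ℂ U)(x) · yᴺ`
  ------------------------------------------------------------------
  set G : MvPolynomial (Fin 2) ℂ :=
    MvPolynomial.C lc⁻¹ * (PC * U).eval₂ (MvPolynomial.C : ℂ →+* MvPolynomial (Fin 2) ℂ) (X 0) * X 1 ^ N
    with hGdef
  have hω : ∀ i, HasAlgCoeffs ((![G, 0] : Fin 2 → MvPolynomial (Fin 2) ℂ) i) := by
    intro i
    fin_cases i
    · show HasAlgCoeffs G
      exact ((hasAlgCoeffs_C hlcalg.inv).mul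
        (Weier.hasAlgCoeffs_eval₂_X_zero (Weier.algPoly_mul hPCalg hUalg))).mul ((hasAlgCoeffs_X 1).pow N)
    · exact hasAlgCoeffs_zero
  -- the integrand of the period
  have hint : ∀ t ∈ Set.Icc (0 : ℝ) 1, ∑ i : Fin 2, eval (γ.toFun t) ((![G, 0] : Fin 2 → _) i) *
      deriv (fun u => γ.toFun u i) t = ((Polynomial.aeval t P₀ / Polynomial.aeval t Q₀ : ℝ) : ℂ) := by
    intro t ht
    have hd : deriv (fun u : ℝ => γ.toFun u 0) t = 1 := by
      have e₀ : (fun u : ℝ => γ.toFun u 0) = ⇑Complex.ofRealCLM := by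
        funext u
        simp [hγ]
      rw [e₀, (Complex.ofRealCLM.hasDerivAt (x := t)).deriv]
      simp
    rw [Fin.sum_univ_two, hd]
    simp only [Matrix.cons_val_zero, Matrix.cons_val_one, Matrix.cons_val_fin_one, map_zero, zero_mul,
      add_zero, mul_one]
    rw [hGdef, map_mul, map_mul, MvPolynomial.eval_C, map_pow, MvPolynomial.eval_X, Weier.eval_eval₂_X_zero,
      Polynomial.eval_mul, hγ]
    simp only [Matrix.cons_val_zero, Matrix.cons_val_one, Matrix.cons_val_fin_one]
    have hR := hrad_ne t ht
    have hq := hQCne t ht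
    have hU := hUeval t ht
    rw [hPCeval, Complex.ofReal_div, ← hQCeval]
    rw [inv_pow, show U.eval (t : ℂ) = lc * (∏ i, ((t : ℂ) - a i)) ^ N / QC.eval (t : ℂ) from by
      rw [eq_div_iff hq, mul_comm, hU]]
    field_simp
  refine ⟨⟨_, isSmoothAffineCurve_puncturedLine ha_alg, ![G, 0], hω, γ⟩, ⟨T.card, a, ha_inj, ha_alg, rfl⟩,
    ?_, hint⟩
  ------------------------------------------------------------------
  -- the realified path is `ℚ`-semialgebraic on `[0,1]`
  ------------------------------------------------------------------
  have hdom : IsSemialgebraic ℚ {z : Fin 1 → ℝ | z 0 ∈ Set.Icc (0 : ℝ) 1} := Realises.isSemialgebraic_IccDom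
  have hfac_sa : ∀ i : Fin T.card,
      IsSemialgebraicFunOn ℚ {z : Fin 1 → ℝ | z 0 ∈ Set.Icc (0 : ℝ) 1} (fun z => (((z 0 : ℝ) : ℂ) - a i).re) ∧
      IsSemialgebraicFunOn ℚ {z : Fin 1 → ℝ | z 0 ∈ Set.Icc (0 : ℝ) 1} (fun z => (((z 0 : ℝ) : ℂ) - a i).im) := by
    intro i
    obtain ⟨hre, him⟩ := isAlgebraic_re_im (ha_alg i)
    exact re_im_sub (re_im_coord hdom) (re_im_const hdom hre him)
  have hprod_sa := Realises.re_im_prod hdom (Finset.univ : Finset (Fin T.card)) (F := fun i z => ((z 0 : ℝ) : ℂ) - a i)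
    fun i _ => hfac_sa i
  have hinv_sa := re_im_inv hprod_sa fun z hz => hrad_ne (z 0) hz
  show IsSemialgebraicMapOn ℚ {z : Fin 1 → ℝ | z 0 ∈ Set.Icc (0 : ℝ) 1}
    (fun z => Fin.append (m := 2) (n := 2) (fun i => (γ.toFun (z 0) i).re) (fun i => (γ.toFun (z 0) i).im))
  refine IsSemialgebraicMapOn.of_forall hdom fun j => ?_
  refine Fin.addCases (fun i => ?_) (fun i => ?_) j
  · simp only [Fin.append_left, hγ]
    fin_cases i
    · exact (re_im_coord hdom).1.congr fun z _ => by simp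
    · exact hinv_sa.1.congr fun z _ => by simp
  · simp only [Fin.append_right, hγ]
    fin_cases i
    · exact (re_im_coord hdom).2.congr fun z _ => by simp
    · exact hinv_sa.2.congr fun z _ => by simp

end Summit.KontsevichZagierPeriods.SymplecticScissors.RealOnePeriodRelations.RationalLayer

end
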